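import Literature.AnabelianGeometry.EtaleTheta.Discharge.Sec5Thm57OfConnectedTemperoidFamily
import Literature.AnabelianGeometry.EtaleTheta.Discharge.Sec5OfConnectedTemperoidYddFacts

/-!
# [EtTh] §5, Theorem 5.7 at ALL levels for the genuine connected-base tower with `A_⊙^bs := Ÿ`, from print's primitive inputs (pp. 329–331 / PDF pp. 103–105)

Mochizuki, *The étale theta function …*, Publ. RIMS **45** (2009)
[cite: MochizukiEtTh2009, Thm 5.7 p.330 (PDF p.104); §5 p.330–331 (PDF pp.104–105); Lem 5.8 p.331 (PDF p.105)].  Seat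
abc-iut-L2-d4 (gen 4; node `EtTh:Thm5.7`); PROOF-ONLY corollary of this seat's
`thetaRootPreservedAll_ofConnectedTemperoidFamily` (p429665) for abc-iut-L2-t4's §5 CHOICE `A_⊙^bs := Ÿ`
(`BiKummerSetting.mkOfConnectedTemperoidYddTower`, `Discharge/Sec5TowerOfConnectedTemperoid.lean`): the two binders that are
theorems there are removed —
* `hH` (`Π^tp_Ÿ ⊆ H_⊙`) := `BiKummerSetting.hH_mkOfConnectedTemperoidYddTower` (abc-iut-L2-t4);
* `hK₁` (Lemma 5.8's "constants act by the cyclotome" at level `1`) := the field `constantsActByCyclotome` of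
  `ThetaFrobenioid.facts_ofConnectedTemperoidData` (abc-iut-L2-t4, p427614) fed with print's TWO primitive inputs at level `1`:
  `hconst₁` (Def. 3.6 (iii): the constants `K'^× ↪ O^×(B_1^birat)` are `Aut`-fixed) and `hgc₁` (Lemma 5.8's geometric
  connectedness: a unit of `B_1` commuting with `s^⊓-gp_1(Π^tp_Y)` is a constant).
`thetaRootPreservedAll_ofConnectedTemperoidYddFamily`: [EtTh] Thm. 5.7 (root level) at ALL levels for the data with inputs EXACTLY
`h, Q, (Rl, R), ιX, (K', constEmb), hinvc/hinvp` (or `hθ`/`hθ'` via abc-iut-L2-t4's `hinvc_family_ofConnectedTemperoid` /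
`hinvp_family_ofConnectedTemperoid`), the Rmk. 4.3.2 transitions with their clauses, MODULO: `hnd`, `hN` (abstract `tf`),
`hconst₁`, `hgc₁`, `hdiv`, `hdesc`, `hnat`, `hfac₁`, `hθ₁`, `hc` (see p429665's docstring for each).
HONEST FRAMING: a kernel-checked implication for data so parametrised (the class `TemperedFrobenioid T₀ (ConnectedPart (BTemp
X.Pi)) VD` is not shown inhabited here); nothing asserts any result of [EtTh] unconditionally; typed ≠ discharged; no side taken
on anything downstream. -/

noncomputable section

namespace Literature.AnabelianGeometry.EtaleTheta

open CategoryTheory Opposite Literature.AlgebraicGeometry.Frobenioids Literature.AnabelianGeometry.SemiGraphs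
  Literature.AnabelianGeometry.SemiGraphs.GaloisObjects

universe u₀ v₀ w

namespace ThetaFrobenioidTower

variable {K : Type u₀} [Field K] {X : SemiGraphs.TemperedArithmeticGroup.{u₀} K} {D₀ : Type u₀} [Category.{v₀} D₀]
  {V : FrdIMonoidStub.{w}} {T₀ : RealifiedDivisorMonoids (D₀ := D₀) V}
  {VD : FrdICatStub.{u₀ + 1, u₀, w} (ConnectedPart (BTemp X.Pi))}
  {tf : TemperedFrobenioid T₀ (ConnectedPart (BTemp X.Pi)) VD} {hZ : tf.monoidType = MonoidType.Z}
  {hP : ∀ A : (ConnectedPart (BTemp X.Pi))ᵒᵖ, IsPerfect (tf.Φ.carrier A)}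
  {NH : Subgroup (Field.absoluteGaloisGroup K) → tf.category → ℕ+ → Prop}
  {E : Set ℕ+} (𝒯 : ThetaEnvTower.{max u₀ w} E) (ιX : 𝒯.PiX ≃ₜ* X.Pi)
  {pullFrac : ∀ {A A' : (BiKummerSetting.mkOfConnectedTemperoidYddTower X tf hZ hP NH 𝒯 ιX).C} (_ : A' ⟶ A),
    (BiKummerSetting.mkOfConnectedTemperoidYddTower X tf hZ hP NH 𝒯 ιX).biratUnits A →
      (BiKummerSetting.mkOfConnectedTemperoidYddTower X tf hZ hP NH 𝒯 ιX).biratUnits A'}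
  {lv : ℕ+}
  {θ : (BiKummerSetting.mkOfConnectedTemperoidYddTower X tf hZ hP NH 𝒯 ιX).biratUnits
    (BiKummerSetting.mkOfConnectedTemperoidYddTower X tf hZ hP NH 𝒯 ιX).Aodot}
  {Bl : (BiKummerSetting.mkOfConnectedTemperoidYddTower X tf hZ hP NH 𝒯 ιX).C}
  {Pl : (BiKummerSetting.mkOfConnectedTemperoidYddTower X tf hZ hP NH 𝒯 ιX).FractionPair θ Bl}
  {Rl : (BiKummerSetting.mkOfConnectedTemperoidYddTower X tf hZ hP NH 𝒯 ιX).NthRoot θ Pl lv pullFrac}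
  (h : ModelFrobenioid.Hypotheses tf.divisorMonoid tf.ratFnFunctor)
  (Q : FrobenioidTheta.ThetaSubquotientStub.{w} (ConnectedPart (BTemp X.Pi))) (odd_l : Odd (lv : ℕ))
  (R : ∀ N : ℕ+, (BiKummerSetting.mkOfConnectedTemperoidYddTower X tf hZ hP NH 𝒯 ιX).NthRoot Rl.root Rl.pair N pullFrac)
  (K' : Type w) [Field K'] (constEmb : ∀ N : ℕ+, K'ˣ →* tf.biratUnitsModel (R N).BN)
  (constEmb_injective : ∀ N : ℕ+, Function.Injective (constEmb N))
  (hinvc : ∀ (N : ℕ+) (g : Aut (R N).AN.base),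
    pull tf.divisorMonoid g.hom (ModelFrobenioid.div (R N).pair.num) = ModelFrobenioid.div (R N).pair.num)
  (hinvp : ∀ (N : ℕ+) (y : 𝒯.PiX), y ∈ 𝒯.PiYdd →
    pull tf.divisorMonoid ((BiKummerSetting.mkOfConnectedTemperoidYddTower X tf hZ hP NH 𝒯 ιX).galoisSurj (R N).AN.base
      (R N).αData.isGalois (ιX y)).hom (ModelFrobenioid.div (R N).pair.den) = ModelFrobenioid.div (R N).pair.den)
  (α : ∀ {N N' : ℕ+}, (N : ℕ) ∣ N' → ((R N').AN ⟶ (R N).AN))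
  (β : ∀ {N N' : ℕ+}, (N : ℕ) ∣ N' → ((R N').BN ⟶ (R N).BN))
  (comm_sCap : ∀ {N N' : ℕ+} (hd : (N : ℕ) ∣ N'), (R N').pair.num ≫ β hd = α hd ≫ (R N).pair.num)
  (comm_sCup : ∀ {N N' : ℕ+} (hd : (N : ℕ) ∣ N'), (R N').pair.den ≫ β hd = α hd ≫ (R N).pair.den)
  (isIsometry_α : ∀ {N N' : ℕ+} (hd : (N : ℕ) ∣ N'),
    ((BiKummerSetting.mkOfConnectedTemperoidYddTower X tf hZ hP NH 𝒯 ιX).sec5Stub h).pre.IsIsometry (α hd))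
  (degFr_α : ∀ {N N' : ℕ+} (hd : (N : ℕ) ∣ N'),
    (((BiKummerSetting.mkOfConnectedTemperoidYddTower X tf hZ hP NH 𝒯 ιX).sec5Stub h).pre.degFr (α hd) : ℕ) * N = N')
  (isIsometry_β : ∀ {N N' : ℕ+} (hd : (N : ℕ) ∣ N'),
    ((BiKummerSetting.mkOfConnectedTemperoidYddTower X tf hZ hP NH 𝒯 ιX).sec5Stub h).pre.IsIsometry (β hd))
  (degFr_β : ∀ {N N' : ℕ+} (hd : (N : ℕ) ∣ N'),
    (((BiKummerSetting.mkOfConnectedTemperoidYddTower X tf hZ hP NH 𝒯 ιX).sec5Stub h).pre.degFr (β hd) : ℕ) * N = N')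
  (baseFrob_α : ∀ {N N' : ℕ+} (hd : (N : ℕ) ∣ N'),
    (BiKummerSetting.mkOfConnectedTemperoidYddTower X tf hZ hP NH 𝒯 ιX).IsOfBaseFrobeniusType (α hd))

include h in
/-- **[EtTh] Theorem 5.7 (root level) at ALL levels for the §5 tower over `B^temp(Π^tp_X)⁰` with `A_⊙^bs := Ÿ`**, from print's
primitive level-`1` inputs `hconst₁` (Def. 3.6 (iii)) and `hgc₁` (Lemma 5.8) in place of `hH`/`hK₁`; remaining binders as in
`thetaRootPreservedAll_ofConnectedTemperoidFamily`.
[cite: MochizukiEtTh2009, Thm 5.7 p.329–330 (PDF pp.103–104); Lem 5.8 p.331 (PDF p.105); §5 p.330 (PDF p.104)] -/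
theorem thetaRootPreservedAll_ofConnectedTemperoidYddFamily
    (hnd : IsNonDilatingOn tf.divisorMonoid)
    (hN : ∃ A : (BiKummerSetting.mkOfConnectedTemperoidYddTower X tf hZ hP NH 𝒯 ιX).C, ¬ (PreFrobenioidData.ofModel tf.divisorMonoid tf.ratFnFunctor tf.divBNatTrans).IsGroupLikeObj A)
    (hconst₁ : ∀ (e : Aut (R 1).BN) (k : K'ˣ), tf.biratAutModel (R 1).BN e (constEmb 1 k) = constEmb 1 k)
    (hgc₁ : ∀ u : (ThetaFrobenioid.ofConnectedTemperoidData (T := 𝒯.level ⟨1, 𝒯.one_mem⟩) h Q odd_l (R 1) ιX K' (constEmb 1)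
        (constEmb_injective 1) (hinvc 1) (hinvp 1)).units (ThetaFrobenioid.ofConnectedTemperoidData (T := 𝒯.level ⟨1, 𝒯.one_mem⟩) h Q odd_l (R 1) ιX K' (constEmb 1)
        (constEmb_injective 1) (hinvc 1) (hinvp 1)).BN,
      (∀ y ∈ (ThetaFrobenioid.ofConnectedTemperoidData (T := 𝒯.level ⟨1, 𝒯.one_mem⟩) h Q odd_l (R 1) ιX K' (constEmb 1)
        (constEmb_injective 1) (hinvc 1) (hinvp 1)).imPiY, (ThetaFrobenioid.ofConnectedTemperoidData (T := 𝒯.level ⟨1, 𝒯.one_mem⟩) h Q odd_l (R 1) ιX K' (constEmb 1)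
        (constEmb_injective 1) (hinvc 1) (hinvp 1)).sgpCap y * (u : Aut (ThetaFrobenioid.ofConnectedTemperoidData (T := 𝒯.level ⟨1, 𝒯.one_mem⟩) h Q odd_l (R 1) ιX K' (constEmb 1)
        (constEmb_injective 1) (hinvc 1) (hinvp 1)).BN) * ((ThetaFrobenioid.ofConnectedTemperoidData (T := 𝒯.level ⟨1, 𝒯.one_mem⟩) h Q odd_l (R 1) ιX K' (constEmb 1)
        (constEmb_injective 1) (hinvc 1) (hinvp 1)).sgpCap y)⁻¹ = u) → (ThetaFrobenioid.ofConnectedTemperoidData (T := 𝒯.level ⟨1, 𝒯.one_mem⟩) h Q odd_l (R 1) ιX K' (constEmb 1)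
        (constEmb_injective 1) (hinvc 1) (hinvp 1)).unitsToBirat (ThetaFrobenioid.ofConnectedTemperoidData (T := 𝒯.level ⟨1, 𝒯.one_mem⟩) h Q odd_l (R 1) ιX K' (constEmb 1)
        (constEmb_injective 1) (hinvc 1) (hinvp 1)).BN u ∈ (ThetaFrobenioid.ofConnectedTemperoidData (T := 𝒯.level ⟨1, 𝒯.one_mem⟩) h Q odd_l (R 1) ιX K' (constEmb 1)
        (constEmb_injective 1) (hinvc 1) (hinvp 1)).constEmb.range)
    (Ψ : (BiKummerSetting.mkOfConnectedTemperoidYddTower X tf hZ hP NH 𝒯 ιX).C ≌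
      (BiKummerSetting.mkOfConnectedTemperoidYddTower X tf hZ hP NH 𝒯 ιX).C)
    (hdiv : ∀ (N : ℕ+) (α' : Ψ.functor.obj ((ofConnectedTemperoidFamily h Q odd_l R ιX K' constEmb constEmb_injective hinvc hinvp α β comm_sCap comm_sCup
      isIsometry_α degFr_α isIsometry_β degFr_β baseFrob_α).AN N) ≅ (ofConnectedTemperoidFamily h Q odd_l R ιX K' constEmb constEmb_injective hinvc hinvp α β comm_sCap comm_sCup
      isIsometry_α degFr_α isIsometry_β degFr_β baseFrob_α).AN N) (β' : Ψ.functor.obj ((ofConnectedTemperoidFamily h Q odd_l R ιX K' constEmb constEmb_injective hinvc hinvp α β comm_sCap comm_sCup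
      isIsometry_α degFr_α isIsometry_β degFr_β baseFrob_α).BN N) ≅ (ofConnectedTemperoidFamily h Q odd_l R ιX K' constEmb constEmb_injective hinvc hinvp α β comm_sCap comm_sCup
      isIsometry_α degFr_α isIsometry_β degFr_β baseFrob_α).BN N),
      ∃ e : (ofConnectedTemperoidFamily h Q odd_l R ιX K' constEmb constEmb_injective hinvc hinvp α β comm_sCap comm_sCup
      isIsometry_α degFr_α isIsometry_β degFr_β baseFrob_α).AN N ≅ (ofConnectedTemperoidFamily h Q odd_l R ιX K' constEmb constEmb_injective hinvc hinvp α β comm_sCap comm_sCup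
      isIsometry_α degFr_α isIsometry_β degFr_β baseFrob_α).AN N,
        (ofConnectedTemperoidFamily h Q odd_l R ιX K' constEmb constEmb_injective hinvc hinvp α β comm_sCap comm_sCup
      isIsometry_α degFr_α isIsometry_β degFr_β baseFrob_α).pre.div (α'.inv ≫ Ψ.functor.map ((ofConnectedTemperoidFamily h Q odd_l R ιX K' constEmb constEmb_injective hinvc hinvp α β comm_sCap comm_sCup
      isIsometry_α degFr_α isIsometry_β degFr_β baseFrob_α).sCap N) ≫ β'.hom) = (ofConnectedTemperoidFamily h Q odd_l R ιX K' constEmb constEmb_injective hinvc hinvp α β comm_sCap comm_sCup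
      isIsometry_α degFr_α isIsometry_β degFr_β baseFrob_α).pre.div (e.hom ≫ (ofConnectedTemperoidFamily h Q odd_l R ιX K' constEmb constEmb_injective hinvc hinvp α β comm_sCap comm_sCup
      isIsometry_α degFr_α isIsometry_β degFr_β baseFrob_α).sCap N) ∧
        (ofConnectedTemperoidFamily h Q odd_l R ιX K' constEmb constEmb_injective hinvc hinvp α β comm_sCap comm_sCup
      isIsometry_α degFr_α isIsometry_β degFr_β baseFrob_α).pre.div (α'.inv ≫ Ψ.functor.map ((ofConnectedTemperoidFamily h Q odd_l R ιX K' constEmb constEmb_injective hinvc hinvp α β comm_sCap comm_sCup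
      isIsometry_α degFr_α isIsometry_β degFr_β baseFrob_α).sCup N) ≫ β'.hom) = (ofConnectedTemperoidFamily h Q odd_l R ιX K' constEmb constEmb_injective hinvc hinvp α β comm_sCap comm_sCup
      isIsometry_α degFr_α isIsometry_β degFr_β baseFrob_α).pre.div (e.hom ≫ (ofConnectedTemperoidFamily h Q odd_l R ιX K' constEmb constEmb_injective hinvc hinvp α β comm_sCap comm_sCup
      isIsometry_α degFr_α isIsometry_β degFr_β baseFrob_α).sCup N))
    (hdesc : ∀ (N : ℕ+) (α' : Ψ.functor.obj ((ofConnectedTemperoidFamily h Q odd_l R ιX K' constEmb constEmb_injective hinvc hinvp α β comm_sCap comm_sCup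
      isIsometry_α degFr_α isIsometry_β degFr_β baseFrob_α).AN N) ≅ (ofConnectedTemperoidFamily h Q odd_l R ιX K' constEmb constEmb_injective hinvc hinvp α β comm_sCap comm_sCup
      isIsometry_α degFr_α isIsometry_β degFr_β baseFrob_α).AN N) (β' : Ψ.functor.obj ((ofConnectedTemperoidFamily h Q odd_l R ιX K' constEmb constEmb_injective hinvc hinvp α β comm_sCap comm_sCup
      isIsometry_α degFr_α isIsometry_β degFr_β baseFrob_α).BN N) ≅ (ofConnectedTemperoidFamily h Q odd_l R ιX K' constEmb constEmb_injective hinvc hinvp α β comm_sCap comm_sCup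
      isIsometry_α degFr_α isIsometry_β degFr_β baseFrob_α).BN N)
      (e : (ofConnectedTemperoidFamily h Q odd_l R ιX K' constEmb constEmb_injective hinvc hinvp α β comm_sCap comm_sCup
      isIsometry_α degFr_α isIsometry_β degFr_β baseFrob_α).AN N ≅ (ofConnectedTemperoidFamily h Q odd_l R ιX K' constEmb constEmb_injective hinvc hinvp α β comm_sCap comm_sCup
      isIsometry_α degFr_α isIsometry_β degFr_β baseFrob_α).AN N) (Dc Dp : Aut ((ofConnectedTemperoidFamily h Q odd_l R ιX K' constEmb constEmb_injective hinvc hinvp α β comm_sCap comm_sCup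
      isIsometry_α degFr_α isIsometry_β degFr_β baseFrob_α).BN N)),
      α'.inv ≫ Ψ.functor.map ((ofConnectedTemperoidFamily h Q odd_l R ιX K' constEmb constEmb_injective hinvc hinvp α β comm_sCap comm_sCup
      isIsometry_α degFr_α isIsometry_β degFr_β baseFrob_α).sCap N) ≫ β'.hom = e.hom ≫ (ofConnectedTemperoidFamily h Q odd_l R ιX K' constEmb constEmb_injective hinvc hinvp α β comm_sCap comm_sCup
      isIsometry_α degFr_α isIsometry_β degFr_β baseFrob_α).sCap N ≫ Dc.hom →
      α'.inv ≫ Ψ.functor.map ((ofConnectedTemperoidFamily h Q odd_l R ιX K' constEmb constEmb_injective hinvc hinvp α β comm_sCap comm_sCup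
      isIsometry_α degFr_α isIsometry_β degFr_β baseFrob_α).sCup N) ≫ β'.hom = e.hom ≫ (ofConnectedTemperoidFamily h Q odd_l R ιX K' constEmb constEmb_injective hinvc hinvp α β comm_sCap comm_sCup
      isIsometry_α degFr_α isIsometry_β degFr_β baseFrob_α).sCup N ≫ Dp.hom →
      ∃ (α₁ : Ψ.functor.obj ((ofConnectedTemperoidFamily h Q odd_l R ιX K' constEmb constEmb_injective hinvc hinvp α β comm_sCap comm_sCup
      isIsometry_α degFr_α isIsometry_β degFr_β baseFrob_α).AN 1) ≅ (ofConnectedTemperoidFamily h Q odd_l R ιX K' constEmb constEmb_injective hinvc hinvp α β comm_sCap comm_sCup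
      isIsometry_α degFr_α isIsometry_β degFr_β baseFrob_α).AN 1) (β₁ : Ψ.functor.obj ((ofConnectedTemperoidFamily h Q odd_l R ιX K' constEmb constEmb_injective hinvc hinvp α β comm_sCap comm_sCup
      isIsometry_α degFr_α isIsometry_β degFr_β baseFrob_α).BN 1) ≅ (ofConnectedTemperoidFamily h Q odd_l R ιX K' constEmb constEmb_injective hinvc hinvp α β comm_sCap comm_sCup
      isIsometry_α degFr_α isIsometry_β degFr_β baseFrob_α).BN 1)
        (e₁ : (ofConnectedTemperoidFamily h Q odd_l R ιX K' constEmb constEmb_injective hinvc hinvp α β comm_sCap comm_sCup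
      isIsometry_α degFr_α isIsometry_β degFr_β baseFrob_α).AN 1 ≅ (ofConnectedTemperoidFamily h Q odd_l R ιX K' constEmb constEmb_injective hinvc hinvp α β comm_sCap comm_sCup
      isIsometry_α degFr_α isIsometry_β degFr_β baseFrob_α).AN 1),
        α'.inv ≫ Ψ.functor.map ((ofConnectedTemperoidFamily h Q odd_l R ιX K' constEmb constEmb_injective hinvc hinvp α β comm_sCap comm_sCup
      isIsometry_α degFr_α isIsometry_β degFr_β baseFrob_α).α (one_dvd_level N)) ≫ α₁.hom = (ofConnectedTemperoidFamily h Q odd_l R ιX K' constEmb constEmb_injective hinvc hinvp α β comm_sCap comm_sCup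
      isIsometry_α degFr_α isIsometry_β degFr_β baseFrob_α).α (one_dvd_level N) ∧
        β'.inv ≫ Ψ.functor.map ((ofConnectedTemperoidFamily h Q odd_l R ιX K' constEmb constEmb_injective hinvc hinvp α β comm_sCap comm_sCup
      isIsometry_α degFr_α isIsometry_β degFr_β baseFrob_α).β (one_dvd_level N)) ≫ β₁.hom = (ofConnectedTemperoidFamily h Q odd_l R ιX K' constEmb constEmb_injective hinvc hinvp α β comm_sCap comm_sCup
      isIsometry_α degFr_α isIsometry_β degFr_β baseFrob_α).β (one_dvd_level N) ∧
        (ofConnectedTemperoidFamily h Q odd_l R ιX K' constEmb constEmb_injective hinvc hinvp α β comm_sCap comm_sCup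
      isIsometry_α degFr_α isIsometry_β degFr_β baseFrob_α).α (one_dvd_level N) ≫ e₁.hom = e.hom ≫ (ofConnectedTemperoidFamily h Q odd_l R ιX K' constEmb constEmb_injective hinvc hinvp α β comm_sCap comm_sCup
      isIsometry_α degFr_α isIsometry_β degFr_β baseFrob_α).α (one_dvd_level N) ∧
        (ofConnectedTemperoidFamily h Q odd_l R ιX K' constEmb constEmb_injective hinvc hinvp α β comm_sCap comm_sCup
      isIsometry_α degFr_α isIsometry_β degFr_β baseFrob_α).pre.div (α₁.inv ≫ Ψ.functor.map ((ofConnectedTemperoidFamily h Q odd_l R ιX K' constEmb constEmb_injective hinvc hinvp α β comm_sCap comm_sCup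
      isIsometry_α degFr_α isIsometry_β degFr_β baseFrob_α).sCap 1) ≫ β₁.hom) = (ofConnectedTemperoidFamily h Q odd_l R ιX K' constEmb constEmb_injective hinvc hinvp α β comm_sCap comm_sCup
      isIsometry_α degFr_α isIsometry_β degFr_β baseFrob_α).pre.div (e₁.hom ≫ (ofConnectedTemperoidFamily h Q odd_l R ιX K' constEmb constEmb_injective hinvc hinvp α β comm_sCap comm_sCup
      isIsometry_α degFr_α isIsometry_β degFr_β baseFrob_α).sCap 1) ∧
        (ofConnectedTemperoidFamily h Q odd_l R ιX K' constEmb constEmb_injective hinvc hinvp α β comm_sCap comm_sCup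
      isIsometry_α degFr_α isIsometry_β degFr_β baseFrob_α).pre.div (α₁.inv ≫ Ψ.functor.map ((ofConnectedTemperoidFamily h Q odd_l R ιX K' constEmb constEmb_injective hinvc hinvp α β comm_sCap comm_sCup
      isIsometry_α degFr_α isIsometry_β degFr_β baseFrob_α).sCup 1) ≫ β₁.hom) = (ofConnectedTemperoidFamily h Q odd_l R ιX K' constEmb constEmb_injective hinvc hinvp α β comm_sCap comm_sCup
      isIsometry_α degFr_α isIsometry_β degFr_β baseFrob_α).pre.div (e₁.hom ≫ (ofConnectedTemperoidFamily h Q odd_l R ιX K' constEmb constEmb_injective hinvc hinvp α β comm_sCap comm_sCup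
      isIsometry_α degFr_α isIsometry_β degFr_β baseFrob_α).sCup 1))
    (hnat : ∀ (N : ℕ+) (c : K'ˣ),
      (tf.ratFnFunctor.map (ModelFrobenioid.baseMap (β (one_dvd_level N))).op).hom
          ((constEmb 1 c : tf.biratUnitsModel (R 1).BN) : tf.ratFnFunctor.obj (op (R 1).BN.base)) =
        ((constEmb N c : tf.biratUnitsModel (R N).BN) : tf.ratFnFunctor.obj (op (R N).BN.base)))
    (hfac₁ : ∀ y ∈ ((ofConnectedTemperoidFamily h Q odd_l R ιX K' constEmb constEmb_injective hinvc hinvp α β comm_sCap comm_sCup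
      isIsometry_α degFr_α isIsometry_β degFr_β baseFrob_α).atLevel 1).imPiY, ∃ x ∈ ((ofConnectedTemperoidFamily h Q odd_l R ιX K' constEmb constEmb_injective hinvc hinvp α β comm_sCap comm_sCup
      isIsometry_α degFr_α isIsometry_β degFr_β baseFrob_α).atLevel 1).HB, ∀ u ∈ ((ofConnectedTemperoidFamily h Q odd_l R ιX K' constEmb constEmb_injective hinvc hinvp α β comm_sCap comm_sCup
      isIsometry_α degFr_α isIsometry_β degFr_β baseFrob_α).atLevel 1).units ((ofConnectedTemperoidFamily h Q odd_l R ιX K' constEmb constEmb_injective hinvc hinvp α β comm_sCap comm_sCup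
      isIsometry_α degFr_α isIsometry_β degFr_β baseFrob_α).BN 1),
      (ofConnectedTemperoidFamily h Q odd_l R ιX K' constEmb constEmb_injective hinvc hinvp α β comm_sCap comm_sCup
      isIsometry_α degFr_α isIsometry_β degFr_β baseFrob_α).sgpCap 1 y * u * ((ofConnectedTemperoidFamily h Q odd_l R ιX K' constEmb constEmb_injective hinvc hinvp α β comm_sCap comm_sCup
      isIsometry_α degFr_α isIsometry_β degFr_β baseFrob_α).sgpCap 1 y)⁻¹ = (ofConnectedTemperoidFamily h Q odd_l R ιX K' constEmb constEmb_injective hinvc hinvp α β comm_sCap comm_sCup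
      isIsometry_α degFr_α isIsometry_β degFr_β baseFrob_α).sgpCap 1 x * u * ((ofConnectedTemperoidFamily h Q odd_l R ιX K' constEmb constEmb_injective hinvc hinvp α β comm_sCap comm_sCup
      isIsometry_α degFr_α isIsometry_β degFr_β baseFrob_α).sgpCap 1 x)⁻¹)
    (hθ₁ : ∀ (α₁ : Ψ.functor.obj ((ofConnectedTemperoidFamily h Q odd_l R ιX K' constEmb constEmb_injective hinvc hinvp α β comm_sCap comm_sCup
      isIsometry_α degFr_α isIsometry_β degFr_β baseFrob_α).AN 1) ≅ (ofConnectedTemperoidFamily h Q odd_l R ιX K' constEmb constEmb_injective hinvc hinvp α β comm_sCap comm_sCup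
      isIsometry_α degFr_α isIsometry_β degFr_β baseFrob_α).AN 1) (β₁ : Ψ.functor.obj ((ofConnectedTemperoidFamily h Q odd_l R ιX K' constEmb constEmb_injective hinvc hinvp α β comm_sCap comm_sCup
      isIsometry_α degFr_α isIsometry_β degFr_β baseFrob_α).BN 1) ≅ (ofConnectedTemperoidFamily h Q odd_l R ιX K' constEmb constEmb_injective hinvc hinvp α β comm_sCap comm_sCup
      isIsometry_α degFr_α isIsometry_β degFr_β baseFrob_α).BN 1)
      (e₁ : (ofConnectedTemperoidFamily h Q odd_l R ιX K' constEmb constEmb_injective hinvc hinvp α β comm_sCap comm_sCup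
      isIsometry_α degFr_α isIsometry_β degFr_β baseFrob_α).AN 1 ≅ (ofConnectedTemperoidFamily h Q odd_l R ιX K' constEmb constEmb_injective hinvc hinvp α β comm_sCap comm_sCup
      isIsometry_α degFr_α isIsometry_β degFr_β baseFrob_α).AN 1) (Dc₁ Dp₁ : Aut ((ofConnectedTemperoidFamily h Q odd_l R ιX K' constEmb constEmb_injective hinvc hinvp α β comm_sCap comm_sCup
      isIsometry_α degFr_α isIsometry_β degFr_β baseFrob_α).BN 1)),
      α₁.inv ≫ Ψ.functor.map ((ofConnectedTemperoidFamily h Q odd_l R ιX K' constEmb constEmb_injective hinvc hinvp α β comm_sCap comm_sCup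
      isIsometry_α degFr_α isIsometry_β degFr_β baseFrob_α).sCap 1) ≫ β₁.hom = e₁.hom ≫ (ofConnectedTemperoidFamily h Q odd_l R ιX K' constEmb constEmb_injective hinvc hinvp α β comm_sCap comm_sCup
      isIsometry_α degFr_α isIsometry_β degFr_β baseFrob_α).sCap 1 ≫ Dc₁.hom →
      α₁.inv ≫ Ψ.functor.map ((ofConnectedTemperoidFamily h Q odd_l R ιX K' constEmb constEmb_injective hinvc hinvp α β comm_sCap comm_sCup
      isIsometry_α degFr_α isIsometry_β degFr_β baseFrob_α).sCup 1) ≫ β₁.hom = e₁.hom ≫ (ofConnectedTemperoidFamily h Q odd_l R ιX K' constEmb constEmb_injective hinvc hinvp α β comm_sCap comm_sCup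
      isIsometry_α degFr_α isIsometry_β degFr_β baseFrob_α).sCup 1 ≫ Dp₁.hom →
      ∃ θ₁ : Aut ((ofConnectedTemperoidFamily h Q odd_l R ιX K' constEmb constEmb_injective hinvc hinvp α β comm_sCap comm_sCup
      isIsometry_α degFr_α isIsometry_β degFr_β baseFrob_α).pre.base.obj ((ofConnectedTemperoidFamily h Q odd_l R ιX K' constEmb constEmb_injective hinvc hinvp α β comm_sCap comm_sCup
      isIsometry_α degFr_α isIsometry_β degFr_β baseFrob_α).BN 1)) ≃* Aut ((ofConnectedTemperoidFamily h Q odd_l R ιX K' constEmb constEmb_injective hinvc hinvp α β comm_sCap comm_sCup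
      isIsometry_α degFr_α isIsometry_β degFr_β baseFrob_α).pre.base.obj ((ofConnectedTemperoidFamily h Q odd_l R ιX K' constEmb constEmb_injective hinvc hinvp α β comm_sCap comm_sCup
      isIsometry_α degFr_α isIsometry_β degFr_β baseFrob_α).BN 1)),
        ((ofConnectedTemperoidFamily h Q odd_l R ιX K' constEmb constEmb_injective hinvc hinvp α β comm_sCap comm_sCup
      isIsometry_α degFr_α isIsometry_β degFr_β baseFrob_α).atLevel 1).StrvTransport Ψ α₁ e₁ θ₁ ∧
        ((ofConnectedTemperoidFamily h Q odd_l R ιX K' constEmb constEmb_injective hinvc hinvp α β comm_sCap comm_sCup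
      isIsometry_α degFr_α isIsometry_β degFr_β baseFrob_α).atLevel 1).HB.map θ₁.toMonoidHom = ((ofConnectedTemperoidFamily h Q odd_l R ιX K' constEmb constEmb_injective hinvc hinvp α β comm_sCap comm_sCup
      isIsometry_α degFr_α isIsometry_β degFr_β baseFrob_α).atLevel 1).HB)
    (hc : ∀ (α₁ : Ψ.functor.obj ((ofConnectedTemperoidFamily h Q odd_l R ιX K' constEmb constEmb_injective hinvc hinvp α β comm_sCap comm_sCup
      isIsometry_α degFr_α isIsometry_β degFr_β baseFrob_α).AN 1) ≅ (ofConnectedTemperoidFamily h Q odd_l R ιX K' constEmb constEmb_injective hinvc hinvp α β comm_sCap comm_sCup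
      isIsometry_α degFr_α isIsometry_β degFr_β baseFrob_α).AN 1) (β₁ : Ψ.functor.obj ((ofConnectedTemperoidFamily h Q odd_l R ιX K' constEmb constEmb_injective hinvc hinvp α β comm_sCap comm_sCup
      isIsometry_α degFr_α isIsometry_β degFr_β baseFrob_α).BN 1) ≅ (ofConnectedTemperoidFamily h Q odd_l R ιX K' constEmb constEmb_injective hinvc hinvp α β comm_sCap comm_sCup
      isIsometry_α degFr_α isIsometry_β degFr_β baseFrob_α).BN 1)
      (e₁ : (ofConnectedTemperoidFamily h Q odd_l R ιX K' constEmb constEmb_injective hinvc hinvp α β comm_sCap comm_sCup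
      isIsometry_α degFr_α isIsometry_β degFr_β baseFrob_α).AN 1 ≅ (ofConnectedTemperoidFamily h Q odd_l R ιX K' constEmb constEmb_injective hinvc hinvp α β comm_sCap comm_sCup
      isIsometry_α degFr_α isIsometry_β degFr_β baseFrob_α).AN 1) (Dc₁ Dp₁ : Aut ((ofConnectedTemperoidFamily h Q odd_l R ιX K' constEmb constEmb_injective hinvc hinvp α β comm_sCap comm_sCup
      isIsometry_α degFr_α isIsometry_β degFr_β baseFrob_α).BN 1)),
      α₁.inv ≫ Ψ.functor.map ((ofConnectedTemperoidFamily h Q odd_l R ιX K' constEmb constEmb_injective hinvc hinvp α β comm_sCap comm_sCup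
      isIsometry_α degFr_α isIsometry_β degFr_β baseFrob_α).sCap 1) ≫ β₁.hom = e₁.hom ≫ (ofConnectedTemperoidFamily h Q odd_l R ιX K' constEmb constEmb_injective hinvc hinvp α β comm_sCap comm_sCup
      isIsometry_α degFr_α isIsometry_β degFr_β baseFrob_α).sCap 1 ≫ Dc₁.hom →
      α₁.inv ≫ Ψ.functor.map ((ofConnectedTemperoidFamily h Q odd_l R ιX K' constEmb constEmb_injective hinvc hinvp α β comm_sCap comm_sCup
      isIsometry_α degFr_α isIsometry_β degFr_β baseFrob_α).sCup 1) ≫ β₁.hom = e₁.hom ≫ (ofConnectedTemperoidFamily h Q odd_l R ιX K' constEmb constEmb_injective hinvc hinvp α β comm_sCap comm_sCup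
      isIsometry_α degFr_α isIsometry_β degFr_β baseFrob_α).sCup 1 ≫ Dp₁.hom →
      ∀ (hu₁ : Dc₁⁻¹ * Dp₁ ∈ ((ofConnectedTemperoidFamily h Q odd_l R ιX K' constEmb constEmb_injective hinvc hinvp α β comm_sCap comm_sCup
      isIsometry_α degFr_α isIsometry_β degFr_β baseFrob_α).atLevel 1).units ((ofConnectedTemperoidFamily h Q odd_l R ιX K' constEmb constEmb_injective hinvc hinvp α β comm_sCap comm_sCup
      isIsometry_α degFr_α isIsometry_β degFr_β baseFrob_α).BN 1)) (c : (ofConnectedTemperoidFamily h Q odd_l R ιX K' constEmb constEmb_injective hinvc hinvp α β comm_sCap comm_sCup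
      isIsometry_α degFr_α isIsometry_β degFr_β baseFrob_α).Kˣ),
        ((ofConnectedTemperoidFamily h Q odd_l R ιX K' constEmb constEmb_injective hinvc hinvp α β comm_sCap comm_sCup
      isIsometry_α degFr_α isIsometry_β degFr_β baseFrob_α).atLevel 1).unitsToBirat ((ofConnectedTemperoidFamily h Q odd_l R ιX K' constEmb constEmb_injective hinvc hinvp α β comm_sCap comm_sCup
      isIsometry_α degFr_α isIsometry_β degFr_β baseFrob_α).BN 1) ⟨Dc₁⁻¹ * Dp₁, hu₁⟩ = (ofConnectedTemperoidFamily h Q odd_l R ιX K' constEmb constEmb_injective hinvc hinvp α β comm_sCap comm_sCup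
      isIsometry_α degFr_α isIsometry_β degFr_β baseFrob_α).constEmb 1 c → c ^ (2 * (ofConnectedTemperoidFamily h Q odd_l R ιX K' constEmb constEmb_injective hinvc hinvp α β comm_sCap comm_sCup
      isIsometry_α degFr_α isIsometry_β degFr_β baseFrob_α).l) = 1) :
    (ofConnectedTemperoidFamily h Q odd_l R ιX K' constEmb constEmb_injective hinvc hinvp α β comm_sCap comm_sCup
      isIsometry_α degFr_α isIsometry_β degFr_β baseFrob_α).ThetaRootPreservedAll Ψ := by
  have H₁ := ThetaFrobenioid.facts_ofConnectedTemperoidData (T := 𝒯.level ⟨1, 𝒯.one_mem⟩) h Q odd_l (R 1) ιX K'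
    (constEmb 1) (constEmb_injective 1) (hinvc 1) (hinvp 1)
    (BiKummerSetting.hH_mkOfConnectedTemperoidYddTower X tf hZ hP NH 𝒯 ιX) hconst₁ hgc₁
  exact thetaRootPreservedAll_ofConnectedTemperoidFamily h Q odd_l R ιX K' constEmb constEmb_injective hinvc hinvp α β
    comm_sCap comm_sCup isIsometry_α degFr_α isIsometry_β degFr_β baseFrob_α
    (BiKummerSetting.hH_mkOfConnectedTemperoidYddTower X tf hZ hP NH 𝒯 ιX) hnd hN H₁.constantsActByCyclotome Ψ hdiv hdesc
    hnat hfac₁ hθ₁ hc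

end ThetaFrobenioidTower

end Literature.AnabelianGeometry.EtaleTheta

end
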